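import Mathlib
import Summits.Schanuel.Schanuel.Statement
import Literature.NumberTheory.Transcendental.RoyCriterion
import Literature.NumberTheory.Transcendental.RoyCriterionProofs
import Literature.NumberTheory.Transcendental.TijdemanZeroEstimateProofs
import Literature.NumberTheory.Transcendental.RoySmallValueRoyD
import Summits.Schanuel.Schanuel.Theorems.SoloBlindPadeNormalForm
import Summits.Schanuel.Schanuel.Theorems.SoloBlindHermitePerfect
import HarnessLib

/-!
# The `D`-orbit of a non-zero form has no common zero off `X₁ = 0`

`Summits/Schanuel/Schanuel/Theorems/SoloBlindOrbitNonvanishing.lean` (soloist `solo-Schanuel-blind`,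
session 13).

Roy's criterion (Acta Arith. 97 (2001), Conjecture 2 ⟺ Schanuel) feeds a sequence of auxiliary
forms `P_N ∈ ℤ[X₀, X₁]` through the ORBIT `{D^k P_N ∘ [m]}` of the invariant derivation
`D = ∂₀ + X₁∂₁` (`royD`) and the translations of `G_a × G_m`.  `SoloBlindHermitePerfect.lean`
certified Hermite's bound at the unit point: `w ↦ P(w, e^w)` vanishes at any `z₀` to order
`< (T₀+1)(T₁+1)` for `P ≠ 0` of bidegree `≤ (T₀, T₁)`.  This file moves the bound to EVERY point
`(ξ, η) ∈ ℂ × ℂˣ` through the generating function `f(w) = P(ξ + w, η e^w)` of the Literature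
(`Roy2013.expEval2`, with `f^{(n)}(0) = (DⁿP)(ξ, η)`, `Roy2013.iteratedDeriv_expEval2_zero`):

* `expEval2_polyOfCoeffs`, `expEval2_polyOfCoeffs_eq_qexp` — the dictionary
  `P(ξ + w, η e^w) = Σ_{b ≤ T₁} [η^b · (Σ_{a ≤ T₀} t(a,b) X^a)(X + ξ)](w) · e^{bw}`, an exponential
  polynomial with the distinct frequencies `0, 1, …, T₁` whose coefficient polynomials are the
  Taylor-shifted `X₁`-slices of `P` scaled by `η^b`.
* `exists_aeval_iterate_royD_ne_zero` — for `P ≠ 0` of bidegree `≤ (T₀, T₁)`, every `ξ ∈ ℂ` and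
  every `η ≠ 0` some `n < (T₀+1)(T₁+1)` has `(DⁿP)(ξ, η) ≠ 0`.
* `exists_iteratedDeriv_expEval2_ne_zero` — equivalently `f = P(ξ + ·, η e^{·})` vanishes at every
  `w₀ ∈ ℂ` to order `< (T₀+1)(T₁+1)`.
* `eq_zero_of_forall_aeval_iterate_royD_eq_zero`, `eq_zero_of_commonZero_iterate_royD` — the
  contrapositive forms: the polynomials `DⁿP`, `n < (deg_{X₀}P + 1)(deg_{X₁}P + 1)`, have no common
  zero in `ℂ × ℂˣ`; a common zero `(ξ, η)` of the whole `D`-orbit has `η = 0`.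

Reading (soloist's wall, §4 R-A3): by Hilbert's Nullstellensatz the ideal generated by the finite
initial segment `{DⁿP : n < (T₀+1)(T₁+1)}` of the orbit contains a power of `X₁`, i.e. the
`D`-closure of any non-zero form is the unit ideal of `ℂ[X₀, X₁^{±1}]` — the algebraic envelope of
Roy's orbit family is trivial, so whatever a criterion "for structured families" consumes, it is
the truncation level `k ≤ N^{s₀} ≪ (T₀+1)(T₁+1) ≍ N^{t₀+t₁}` together with the metric profile, not
an ideal-theoretic invariant.  (The Nullstellensatz step itself is not formalised here.)

No definitions.  References: C. Hermite, *Sur la fonction exponentielle*, C. R. Acad. Sci. Paris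
77 (1873); D. Roy, *An arithmetic criterion for the values of the exponential function*, Acta
Arith. 97 (2001) 183–194, §§4–5; D. Roy, *A small value estimate for `G_a × G_m`*, Mathematika 59
(2013), §7 (the generating function `f_F`).
-/

noncomputable section

open scoped Classical
open Complex Polynomial Finset

namespace Summit.Schanuel.Schanuel.Theorems

open Literature.NumberTheory.Transcendental Literature.NumberTheory.Transcendental.Tijdeman
  Literature.NumberTheory.Transcendental.Roy2013

/-! ### The dictionary at a general point `(ξ, η)` -/

/-- `polyOfCoeffs t (ξ + w, η e^w) = Σ t(a,b) (ξ + w)^a (η e^w)^b`. [folklore] -/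
theorem expEval2_polyOfCoeffs {T₀ T₁ : ℕ} (t : Fin (T₀ + 1) × Fin (T₁ + 1) → ℤ) (ξ η w : ℂ) :
    expEval2 (polyOfCoeffs t) ξ η w =
      ∑ ab, (t ab : ℂ) * ((ξ + w) ^ (ab.1 : ℕ) * (η * cexp w) ^ (ab.2 : ℕ)) := by
  simp [expEval2, polyOfCoeffs, monoXY, map_sum, map_mul, map_pow]

/-- **The dictionary at `(ξ, η)`.** `P(ξ + w, η e^w)` for `P = polyOfCoeffs t` is the exponential
polynomial `Σ_{b ≤ T₁} Q_b(w) e^{bw}` with `Q_b = η^b · (Σ_a t(a,b) X^a)∘(X + ξ)` (Taylor shift of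
the `X₁`-slice) and frequencies `b = 0, 1, …, T₁`. [this work; folklore] -/
theorem expEval2_polyOfCoeffs_eq_qexp {T₀ T₁ : ℕ} (t : Fin (T₀ + 1) × Fin (T₁ + 1) → ℤ)
    (ξ η : ℂ) :
    expEval2 (polyOfCoeffs t) ξ η =
      qexp (fun b : Fin (T₁ + 1) =>
          C (η ^ (b : ℕ)) * taylor ξ (∑ a : Fin (T₀ + 1), C ((t (a, b) : ℂ)) * X ^ (a : ℕ)))
        (fun b => ((b : ℕ) : ℂ)) := by
  funext w
  have hpow : ∀ a : ℕ, (w + ξ) ^ a = (ξ + w) ^ a := fun a => by rw [add_comm]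
  rw [expEval2_polyOfCoeffs, Fintype.sum_prod_type, Finset.sum_comm]
  simp only [qexp, eval_mul, eval_C, taylor_eval, eval_finsetSum, eval_pow, eval_X, hpow,
    Finset.mul_sum, Finset.sum_mul, Complex.exp_nat_mul]
  refine Finset.sum_congr rfl fun b _ => Finset.sum_congr rfl fun a _ => ?_
  ring

/-! ### Hermite's bound at every point of `ℂ × ℂˣ` -/

/-- **No common zero of the `D`-orbit off `X₁ = 0`.** For a non-zero `P ∈ ℤ[X₀, X₁]` with
`deg_{X₀} P ≤ T₀`, `deg_{X₁} P ≤ T₁`, every `ξ ∈ ℂ` and every `η ≠ 0`, some `n < (T₀+1)(T₁+1)` has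
`(DⁿP)(ξ, η) ≠ 0` (`D = ∂₀ + X₁∂₁`).  Proof: `(DⁿP)(ξ, η)` is the `n`-th derivative at `0` of
`P(ξ + w, η e^w)`, a non-trivial exponential polynomial with `T₁ + 1` distinct frequencies and
coefficient degrees `≤ T₀`, to which Hermite's bound `qexp_eq_zero_of_iteratedDeriv_eq_zero`
applies. [this work; folklore] -/
theorem exists_aeval_iterate_royD_ne_zero {T₀ T₁ : ℕ} (P : MvPolynomial (Fin 2) ℤ) (hP : P ≠ 0)
    (h0 : P.degreeOf 0 ≤ T₀) (h1 : P.degreeOf 1 ≤ T₁) (ξ : ℂ) {η : ℂ} (hη : η ≠ 0) :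
    ∃ n < (T₀ + 1) * (T₁ + 1), MvPolynomial.aeval ![ξ, η] (royD^[n] P) ≠ 0 := by
  set t : Fin (T₀ + 1) × Fin (T₁ + 1) → ℤ := fun ab => P.coeff (boxExp ab) with ht
  have hPt : polyOfCoeffs t = P := polyOfCoeffs_coeff_boxExp P h0 h1
  have hσ : Function.Injective (fun b : Fin (T₁ + 1) => ((b : ℕ) : ℂ)) := by
    intro b b' h
    simp only at h
    exact Fin.ext (by exact_mod_cast h)
  -- the plain slices of `P` are not all zero
  have hS0 : (fun b : Fin (T₁ + 1) => ∑ a : Fin (T₀ + 1), C ((t (a, b) : ℂ)) * X ^ (a : ℕ))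
      ≠ 0 := by
    intro hS
    apply hP
    rw [← hPt, eq_zero_of_slices_eq_zero t hS]
    simp [polyOfCoeffs]
  -- hence neither are the shifted, `η^b`-scaled slices
  have hQ0 : (fun b : Fin (T₁ + 1) =>
      C (η ^ (b : ℕ)) * taylor ξ (∑ a : Fin (T₀ + 1), C ((t (a, b) : ℂ)) * X ^ (a : ℕ))) ≠ 0 := by
    intro hQ
    apply hS0
    funext b
    have hb := congr_fun hQ b
    simp only [Pi.zero_apply] at hb ⊢
    rcases mul_eq_zero.mp hb with h | h
    · exact absurd (C_eq_zero.mp h) (pow_ne_zero _ hη)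
    · exact taylor_injective ξ (by rw [h, map_zero])
  -- their size is at most `(T₀+1)(T₁+1)`
  have hsize : (∑ b : Fin (T₁ + 1),
      if (fun b : Fin (T₁ + 1) =>
            C (η ^ (b : ℕ)) * taylor ξ (∑ a : Fin (T₀ + 1), C ((t (a, b) : ℂ)) * X ^ (a : ℕ))) b = 0
        then 0 else
          ((fun b : Fin (T₁ + 1) =>
              C (η ^ (b : ℕ)) * taylor ξ (∑ a : Fin (T₀ + 1), C ((t (a, b) : ℂ)) * X ^ (a : ℕ))) b
            ).natDegree + 1) ≤ (T₀ + 1) * (T₁ + 1) := by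
    calc _ ≤ ∑ _b : Fin (T₁ + 1), (T₀ + 1) := Finset.sum_le_sum fun b _ => ?_
      _ = (T₀ + 1) * (T₁ + 1) := by simp [mul_comm]
    split_ifs
    · exact Nat.zero_le _
    · refine Nat.succ_le_succ ((natDegree_C_mul_le _ _).trans ?_)
      rw [natDegree_taylor]
      exact natDegree_sum_le_of_forall_le _ _ fun a _ =>
        (natDegree_C_mul_X_pow_le _ _).trans (Nat.lt_succ_iff.mp a.isLt)
  obtain ⟨n, hn, hne⟩ := exists_iteratedDeriv_qexp_ne_zero hσ hQ0 0
  refine ⟨n, lt_of_lt_of_le hn hsize, ?_⟩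
  rwa [← expEval2_polyOfCoeffs_eq_qexp t ξ η, hPt, iteratedDeriv_expEval2_zero] at hne

/-- **Hermite's bound along every translate.** For `P ≠ 0` of bidegree `≤ (T₀, T₁)`, `η ≠ 0` and
any `w₀ ∈ ℂ`, the function `w ↦ P(ξ + w, η e^w)` vanishes at `w₀` to order `< (T₀+1)(T₁+1)`
(translate: `P(ξ + w₀ + w, (η e^{w₀}) e^w)`). [this work; folklore] -/
theorem exists_iteratedDeriv_expEval2_ne_zero {T₀ T₁ : ℕ} (P : MvPolynomial (Fin 2) ℤ)
    (hP : P ≠ 0) (h0 : P.degreeOf 0 ≤ T₀) (h1 : P.degreeOf 1 ≤ T₁) (ξ : ℂ) {η : ℂ} (hη : η ≠ 0)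
    (w₀ : ℂ) :
    ∃ n < (T₀ + 1) * (T₁ + 1), iteratedDeriv n (expEval2 P ξ η) w₀ ≠ 0 := by
  have hη' : η * cexp w₀ ≠ 0 := mul_ne_zero hη (Complex.exp_ne_zero _)
  obtain ⟨n, hn, hne⟩ := exists_aeval_iterate_royD_ne_zero P hP h0 h1 (ξ + w₀) hη'
  refine ⟨n, hn, ?_⟩
  have hshift : (fun w => expEval2 P ξ η (w₀ + w)) = expEval2 P (ξ + w₀) (η * cexp w₀) := by
    funext w
    simp only [expEval2, Complex.exp_add, add_assoc, mul_assoc]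
  have key := congr_fun (iteratedDeriv_comp_const_add n (expEval2 P ξ η) w₀) 0
  rw [hshift, iteratedDeriv_expEval2_zero, add_zero] at key
  rwa [← key]

/-- Contrapositive form: if `η ≠ 0` and `(DⁿP)(ξ, η) = 0` for all `n < (T₀+1)(T₁+1)`, where
`deg P ≤ (T₀, T₁)`, then `P = 0`. [this work; folklore] -/
theorem eq_zero_of_forall_aeval_iterate_royD_eq_zero {T₀ T₁ : ℕ} (P : MvPolynomial (Fin 2) ℤ)
    (h0 : P.degreeOf 0 ≤ T₀) (h1 : P.degreeOf 1 ≤ T₁) (ξ : ℂ) {η : ℂ} (hη : η ≠ 0)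
    (h : ∀ n < (T₀ + 1) * (T₁ + 1), MvPolynomial.aeval ![ξ, η] (royD^[n] P) = 0) : P = 0 := by
  by_contra hP
  obtain ⟨n, hn, hne⟩ := exists_aeval_iterate_royD_ne_zero P hP h0 h1 ξ hη
  exact hne (h n hn)

/-- **Common zeros of the `D`-orbit lie on `X₁ = 0`.** If `(ξ, η)` is a common zero of
`DⁿP`, `n < (deg_{X₀}P + 1)(deg_{X₁}P + 1)`, for a non-zero `P`, then `η = 0`; by the
Nullstellensatz (not formalised) the ideal `(DⁿP : n < (deg_{X₀}P+1)(deg_{X₁}P+1))` then contains a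
power of `X₁`. [this work; folklore] -/
theorem eq_zero_of_commonZero_iterate_royD (P : MvPolynomial (Fin 2) ℤ) (hP : P ≠ 0) (ξ η : ℂ)
    (h : ∀ n < (P.degreeOf 0 + 1) * (P.degreeOf 1 + 1),
      MvPolynomial.aeval ![ξ, η] (royD^[n] P) = 0) : η = 0 := by
  by_contra hη
  exact hP (eq_zero_of_forall_aeval_iterate_royD_eq_zero P le_rfl le_rfl ξ hη h)

end Summit.Schanuel.Schanuel.Theorems

end
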